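import Literature.NumberTheory.LFunctions.WeilExplicit
import Literature.NumberTheory.LFunctions.WeilExplicitProofs
import Literature.NumberTheory.LFunctions.WeilMellinBounds
import Literature.NumberTheory.LFunctions.WeilMellinInversion
import Literature.NumberTheory.LFunctions.WeilMellinPolyDecay
import Mathlib.Analysis.SpecialFunctions.ImproperIntegrals
import Mathlib.MeasureTheory.Integral.Prod

/-!
# Stub `stub_polePairing` for crux `SignCone.SignConeOscillatory` (stmt-RiemannHypothesis-16302), line Sketch

The pole term of the order-zero Euler–Maclaurin formula for `ζ` paired with the Weil transform
`F̂(s) = weilMellin F s = ∫ F(t) e^{(s - 1/2)t} dt` on the critical line `s = 1/2 + iy`: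
for a Weil test function `F` with `tsupport F ⊆ (-∞, log N]`,
`∫ F̂(1/2 + iy) N^{1 - s}/(s - 1) dy = -2π F̂(1)`.

Proof (mirror of `Literature.NumberTheory.LFunctions.integral_weilMellin_vertical_div_sub`, the
pole now lying to the RIGHT of the line): on `Re s = c < Re a`,
`e^{(a - s)L}/(s - a) = -∫_{-L}^∞ e^{(s - a)x} dx` (`integral_exp_mul_complex_Ioi`), Fubini, and
Mellin inversion `∫ F̂(c + iy) e^{(c - 1/2 + iy)x} dy = 2π F(-x)` (`weilMellin_inversion'`) give
`∫ F̂(c + iy) e^{(a - s)L}/(s - a) dy = -2π ∫_{x ≤ L} F(x) e^{(a - 1/2)x} dx`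
(`integral_weilMellin_vertical_mul_exp_div_sub`). With `c = 1/2`, `a = 1`, `L = log N`,
`N^{1 - s} = e^{(1 - s) log N}` and `F = 0` on `(log N, ∞)` this is `-2π F̂(1)`.
-/

noncomputable section
set_option linter.dupNamespace false
open scoped BigOperators ComplexConjugate Real
open Complex MeasureTheory Set Filter

namespace Summit.RiemannHypothesis.RiemannHypothesis.Theorems.SignConeOscillatory

open Literature.NumberTheory.LFunctions

/-- **Polar term with the pole to the right of the line.** For a Weil test function `g`, a real
`c`, a complex `a` with `c < Re a` and a real `L`, the factor `e^{(a - s)L}/(s - a)` is continuous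
and bounded on `s = c + iy`, so `y ↦ ĝ(c + iy) e^{(a - s)L}/(s - a)` is integrable, and
`∫ ĝ(c + iy) e^{(a - s)L}/(s - a) dy = -2π ∫_{x ≤ L} g(x) e^{(a - 1/2)x} dx`
(`e^{(a - s)L}/(s - a) = -∫_{-L}^∞ e^{(s - a)x} dx`, Fubini, Mellin inversion). -/
theorem integral_weilMellin_vertical_mul_exp_div_sub {g : ℝ → ℂ} (hg : IsWeilTest g) {c : ℝ}
    {a : ℂ} (hca : c < a.re) (L : ℝ) :
    Integrable (fun y : ℝ => weilMellin g (c + y * I) *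
        (cexp ((a - (c + y * I)) * L) / (c + y * I - a))) ∧
    ∫ y : ℝ, weilMellin g (c + y * I) * (cexp ((a - (c + y * I)) * L) / (c + y * I - a)) =
      -(2 * π * ∫ x in Iic L, g x * cexp ((a - 1 / 2) * x)) := by
  have hgc : Continuous g := hg.1.continuous
  have hcont : Continuous (weilMellin g) := continuous_weilMellin hgc hg.2
  have hac : 0 < a.re - c := sub_pos.2 hca
  have hne : ∀ y : ℝ, (c : ℂ) + y * I - a ≠ 0 := fun y h0 => by
    have := congrArg Complex.re h0
    simp at this
    linarith
  refine ⟨?_, ?_⟩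
  · -- integrability: the factor is continuous and bounded by `e^{(Re a - c)L}/(Re a - c)`
    have hFc : Continuous fun y : ℝ => cexp ((a - (c + y * I)) * L) / (c + y * I - a) :=
      Continuous.div₀ (by fun_prop) (by fun_prop) hne
    refine integrable_weilMellin_vertical_mul hg c hFc
      (B := Real.exp ((a.re - c) * L) / (a.re - c)) fun y => ?_
    rw [norm_div, Complex.norm_exp]
    have hre : ((a - (c + y * I)) * (L : ℂ)).re = (a.re - c) * L := by
      simp [sub_re, mul_re]
    rw [hre]
    refine div_le_div_of_nonneg_left (Real.exp_pos _).le hac ?_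
    have h := Complex.abs_re_le_norm ((c : ℂ) + y * I - a)
    have h' : ((c : ℂ) + y * I - a).re = c - a.re := by simp
    rw [h', abs_sub_comm, abs_of_pos hac] at h
    exact h
  · -- Step 1: `e^{(a - s)L}/(s - a) = -∫_{-L}^∞ e^{(s - a)x} dx` on the line.
    have hrep : ∀ y : ℝ, cexp ((a - (c + y * I)) * L) / (c + y * I - a) =
        -∫ x in Ioi (-L), cexp ((c + y * I - a) * x) := by
      intro y
      have hre : ((c : ℂ) + y * I - a).re < 0 := by simp; linarith
      rw [integral_exp_mul_complex_Ioi hre (-L)]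
      have e : ((c : ℂ) + y * I - a) * ((-L : ℝ) : ℂ) = (a - (c + y * I)) * L := by
        push_cast; ring
      rw [e, neg_div, neg_neg]
    have step1 : (fun y : ℝ => weilMellin g (c + y * I) *
        (cexp ((a - (c + y * I)) * L) / (c + y * I - a))) = fun y : ℝ =>
          -∫ x in Ioi (-L), weilMellin g (c + y * I) * cexp ((c + y * I - a) * x) := by
      funext y
      rw [hrep y, mul_neg, ← integral_const_mul]
    rw [step1, integral_neg]
    -- Step 2: Fubini.
    have hint : Integrable (Function.uncurry fun (y : ℝ) (x : ℝ) =>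
        weilMellin g (c + y * I) * cexp ((c + y * I - a) * x))
        ((volume : Measure ℝ).prod (volume.restrict (Ioi (-L)))) := by
      have h1 : Integrable (fun y : ℝ => weilMellin g (c + y * I)) :=
        integrable_weilMellin_vertical hg c
      have h2 : Integrable (fun x : ℝ => cexp ((c - a) * x)) (volume.restrict (Ioi (-L))) :=
        integrableOn_exp_mul_complex_Ioi (by simp; linarith) (-L)
      refine Integrable.mono' (h1.mul_prod h2).norm ?_ (Eventually.of_forall fun p => ?_)
      · exact (by fun_prop : Continuous (Function.uncurry fun (y : ℝ) (x : ℝ) =>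
          weilMellin g (c + y * I) * cexp ((c + y * I - a) * x))).aestronglyMeasurable
      · obtain ⟨y, x⟩ := p
        simp only [Function.uncurry_apply_pair, norm_mul, Complex.norm_exp]
        refine le_of_eq ?_
        congr 2
        simp [sub_re, mul_re]
    rw [integral_integral_swap hint]
    -- Step 3: inner integral by Mellin inversion at `t = -x`.
    have inner : ∀ x : ℝ, (∫ y : ℝ, weilMellin g (c + y * I) * cexp ((c + y * I - a) * x)) =
        cexp ((1 / 2 - a) * x) * (2 * π * g (-x)) := by
      intro x
      rw [← weilMellin_inversion' hg c (-x), ← integral_const_mul]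
      congr 1 with y
      have e : cexp (((c : ℂ) + y * I - a) * x) =
          cexp ((1 / 2 - a) * x) * cexp (-((c - 1 / 2 : ℂ) + y * I) * ((-x : ℝ) : ℂ)) := by
        rw [← Complex.exp_add]
        congr 1
        push_cast
        ring
      rw [e]
      ring
    simp_rw [inner]
    -- Step 4: `x ↦ -x`.
    have hneg := integral_comp_neg_Ioi (-L) (fun u : ℝ => g u * cexp ((a - 1 / 2) * u))
    simp only [neg_neg] at hneg
    rw [← hneg, ← integral_const_mul]
    congr 2 with x
    have e : (a - 1 / 2) * ((-x : ℝ) : ℂ) = (1 / 2 - a) * x := by push_cast; ring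
    rw [e]
    ring

/-- STUB `stub_polePairing` (card A, the pole term of Euler–Maclaurin of order zero on the critical
line). For a Weil test `F` supported in `(-∞, log N]`, `N ≥ 1`, the pole term `N^{1-s}/(s-1)` of
`ζ(s)` pairs with `F̂` on `Re s = 1/2` to `-2π F̂(1)`:
`∫ F̂(1/2 + iy) N^{1/2 - iy}/(iy - 1/2) dy = -2π F̂(1)`, the integrand being integrable. -/
theorem stub_polePairing :
    ∀ (F : ℝ → ℂ) (N : ℕ), 1 ≤ N → IsWeilTest F → tsupport F ⊆ Set.Iic (Real.log N) →
      Integrable (fun y : ℝ => weilMellin F (1 / 2 + y * I) *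
          ((N : ℂ) ^ (1 - (1 / 2 + y * I)) / ((1 / 2 + y * I) - 1))) ∧
      ∫ y : ℝ, weilMellin F (1 / 2 + y * I) *
          ((N : ℂ) ^ (1 - (1 / 2 + y * I)) / ((1 / 2 + y * I) - 1))
        = -(2 * π * weilMellin F 1) := by
  intro F N hN hF hsupp
  have hN0 : (0 : ℝ) < N := by exact_mod_cast hN
  have hNC : (N : ℂ) ≠ 0 := by exact_mod_cast hN0.ne'
  have hlog : Complex.log (N : ℂ) = ((Real.log N : ℝ) : ℂ) := by
    rw [← Complex.ofReal_natCast, ← Complex.ofReal_log hN0.le]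
  have hhalf : ((1 / 2 : ℝ) : ℂ) = 1 / 2 := by push_cast; ring
  have key := integral_weilMellin_vertical_mul_exp_div_sub hF (c := 1 / 2) (a := 1)
    (by norm_num) (Real.log N)
  simp only [hhalf] at key
  have e : ∀ y : ℝ, (N : ℂ) ^ (1 - (1 / 2 + (y : ℂ) * I)) =
      cexp ((1 - (1 / 2 + (y : ℂ) * I)) * ((Real.log N : ℝ) : ℂ)) := fun y => by
    rw [Complex.cpow_def_of_ne_zero hNC, hlog, mul_comm]
  simp_rw [e]
  refine ⟨key.1, ?_⟩
  rw [key.2]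
  congr 2
  unfold weilMellin
  exact setIntegral_eq_integral_of_forall_compl_eq_zero fun x hx => by
    rw [image_eq_zero_of_notMem_tsupport (fun h => hx (hsupp h)), zero_mul]

end Summit.RiemannHypothesis.RiemannHypothesis.Theorems.SignConeOscillatory

end
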